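import Summits.Langlands.Langlands.Theses.EisensteinGelfandKirillov
import Literature.NumberTheory.Automorphic.GLnAdelicStructureProofs

/-!
# Line `noether-flat-occupancy` for the crux `EisensteinGelfandKirillov.CrystallineProModularClassical`
(stmt-Langlands-18274, THE EXIT of route `route-Langlands-EisensteinGelfandKirillov`) — crux-plan skeleton

Crux-plan of the idea `Ideas/noether-flat-occupancy.md` (crux-ideate round 2, ideator 4; TRIAGE-r2-1 pass,
TRIAGE-r2-2 pass) by planner-cruxplan-stmt-Langlands-18274-noether-flat-occupan-0, 2026-08-17.
Line card: `Lines/noether-flat-occupancy.md`.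

## Composition idea

Both dead lines of this crux (`Sketch`, `LadderCollapse`) died at K0 = "a pro-modular POINT has an
EIGENVECTOR" (`Lines/Sketch-dead.md` §1–2).  This line gives K0 a MECHANISM and cuts it into three
registered stubs on the TOTALLY DEFINITE quaternionic tower (where completed homology is Λ-free and
there is no boundary), followed by ONE exit stub from the eigenvector; the parity of `d = [F:ℚ]`
(a totally definite quaternion algebra unramified at all finite places exists iff `d` is even) is
handled by a quadratic totally real ascent/descent, NOT by a case split of the exit:

* `stub_definiteCarrier` (card S4/P1, size L) — for `d` even: the crux's continuous `ℚ̄_p`-point of the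
  all-degree `GL₂` big Hecke algebra `𝕋(K^p)` with irreducible odd `ρ` is an `O`-point `x` of the
  finite-level Hecke algebras of a totally definite quaternionic tower `S(U(r), O)` (`D = ℍ(a,b)_F`
  split above `p`, `U(r) = U(0) ∩ (1 + p^r Ô)`), with `T_v`-eigenvalues the Frobenius traces of `ρ`.
* `stub_gkBoundAtPoint` (card S5 = DOOR⁺, size XL, the route's bet transported to the point) — the
  Gelfand–Kirillov bound at the maximal ideal `𝔪_x̄` of such a point, in the door's growth form:
  `dim_k S(U(r), k)[𝔪_x̄] ≤ C · p^(r[F:ℚ])`, the eigen-equations being imposed through Hecke elements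
  `g` SUPPORTED AT `v` (so `T_g = T_v` is canonical and the level-collapse witness of
  `Cruxes/EisensteinGKBound/Disproof.lean` (`eisensteinGKBoundNondeg_holds`) does not bite).
* `stub_noetherFlatOccupancy` (card S1 = THE NEW ALGEBRA, size L/XL, load-bearing) — GK bound at
  `𝔪_x̄` + point ⇒ OCCUPANCY of `x`: primitive exact `T_v`-eigenforms modulo `p^e` at some level,
  for every `e` (⟺ `Ŝ(U^p)_E[𝔭_x] ≠ 0`, see "Typing" below).  Intended proof = the card's (A)–(D):
  dimension sandwich `dim 𝕋_𝔪 = 1 + 2[F:ℚ]` (door ⇒ `≥` by Pan's (dh) argument; Newton–Thorne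
  arXiv:1912.11265 Thm 2 ⇒ `≤`), Gee–Newton MIRACLE FLATNESS (arXiv:1609.06965 App. Prop. 26, stated
  for an arbitrary power-series coefficient ring) over a NOETHER NORMALISATION `A = O'⟦u₁…u_{2d}⟧ ⊂ 𝕋_𝔪`
  through `𝔭_x`, SATURATION DESCENT through the `2d` regular quotients (the triage's
  "saturation-integrality lemma" — the first checkable NEW statement, to be attached `--supports`),
  Artinian Nakayama (tree: `exists_ne_zero_forall_apply_eq_smul_of_algHom`).
* `stub_exitFromOccupancy` (card S6 = OCC-EXIT, size XL, hardest, the crux's open content) — an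
  OCCUPIED point whose `ρ` is irreducible, odd, crystalline with distinct labelled Hodge–Tate weights
  at `v ∣ p` is classical: an L-algebraic cuspidal `π` on `GL₂(𝔸_F)` of REGULAR L-algebraic infinity
  type with Satake–Frobenius matching a.e.  (On the definite tower "classical" is "`Π_x` has non-zero
  locally algebraic vectors" — Emerton's Jacquet-module route = the item's intended proof, or any
  locally-algebraic-vectors theorem; this is where crystallinity is consumed, as Disproof §1h demands.)
* `stub_oddDegreeAscent` (size L) — for `d` odd: a totally real quadratic `F'/F` (so `[F':ℚ]` even,
  `p` unramified in `F'`) over which `ρ|_{Γ_{F'}}` is still irreducible, odd, a.e. unramified,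
  PRO-MODULAR (base change of the completed-cohomology point — the non-formal clause) and
  crystalline labelled-HT-regular above `p`.
* `stub_quadraticDescent` (size M/L, in print modulo assembly) — Langlands' quadratic base-change
  DESCENT: a regular L-algebraic cuspidal `π'` on `GL₂(𝔸_{F'})` matching `ρ|_{Γ_{F'}}` (irreducible)
  a.e. comes from a cuspidal L-algebraic `π` on `GL₂(𝔸_F)` matching `ρ` a.e. (strong multiplicity one,
  cyclic descent `cuspidal_descent_cyclic`, Galois representations of cohomological Hilbert eigenforms,
  `ρ ≅ ρ_π ⊗ η^i`).

Pure logic (`§2`, no `sorry`): `cruxEvenDegree` = S4 → S5 → S1 → S6 for even `d`;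
`CrystallineProModularClassical_of` = `Nat.even_or_odd d`; even: `cruxEvenDegree`; odd:
`stub_oddDegreeAscent` → `cruxEvenDegree` over `F'` (with `isCompact_glFiniteIntegralLevel_holds 2 F'`)
→ `stub_quadraticDescent`.  Concludes
`Summit.Langlands.Langlands.Theses.EisensteinGelfandKirillov.CrystallineProModularClassical` BY NAME.

## Typing (all stubs are closed statements over EXISTING declarations; no `let`, no notation, no new def)

* TOWER DATUM `(a, b, S, U)`: `D = QuaternionAlgebra F a 0 b` (`a b : 𝓞 F` non-zero) totally definite
  (`IsTotallyDefinite`), split at every `v ∣ p` with `a b` units at `p` (so the coordinate order is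
  `M₂(𝒪_v)` there); `S ⊇ {v ∣ 2pab}`; `U : ℕ → Subgroup (finiteAdelicUnits F D)` with
  `u ∈ U r ↔ u ∈ U 0 ∧ Φ(u) ≡ 1 (mod p^r Ô)` (the door's congruence clause, relative to an arbitrary
  open `U 0 ≤ Ô^× = integralUnits a b` that is HYPERSPECIAL off `S`: every `γ ∈ Ô^×` supported at a
  single `v ∉ S` lies in `U 0`), `[∀ r, IsHeckeTriple ⊤ (U r) (U r)]`.
* HECKE ELEMENT AT `v ∉ S` (the predicate written out each time): `Φ g ∈ Ô` (integral), `g ≡ 1` off `v`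
  (`adelicCoords a b (↑g - 1) i w = 0` for `w ≠ v` — the refuter's repair of the door, triage r2-2),
  and the coordinate norm form of `g` has valuation `exp (-1)` at `v` and `1` elsewhere.  Then
  `U(r) g U(r)` is the `T_v` double coset for EVERY such `g` (the `v`-component of `U(r)` is `GL₂(𝒪_v)`).
  Only `T_v` is used (no `S_v`): exact `T_v`-eigenforms with non-zero eigenvalues on a set of places of
  positive density are pinned on boundedly many reduced-norm fibres (NOTES-ideator4-r2 §5, TRIAGE-r2-2
  panel note), so the central `p`-group contributes no growth; association with `ρ` is by TRACE
  (`HasFrobCharpolyAt v (X² − C (x v) X + C c)` for some `c`), which determines an irreducible `ρ`.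
* COEFFICIENTS `O` = the valuation ring of `ℚ̄_p` (binder `O` with `O = Valued.v.valuationSubring`, as in
  the route's target; pro-modular points are integral, `hpm_point_integral`).  A prover descends to a
  finite `E/ℚ_p` (the image of a compact ring in `ℚ̄_p` lies in a finite extension, Baire).
* POINT (hypothesis of S5/S1, output of S4): `∀ e, ∃ r, ∃ φ : Algebra.adjoin O {T_g : g Hecke at some v ∉ S}
  →ₐ[O] O ⧸ (p^e)` (inside `Module.End O (QuaternionicForm D (U r) O)`) with `φ T_g = x v (mod p^e)`.
  Equivalent to a continuous `O`-point of the closure `𝕋^D(U^p) ⊂ ∏_{r,s} End(S(U(r), O/p^s))`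
  (the `p`-saturation of `O[T]` in `End_O S(U(r),O)` has bounded index).
* OCCUPANCY (output of S1, hypothesis of S6): `∀ e, ∃ r, ∃ f : QuaternionicForm D (U r) (O ⧸ (p^e))`,
  PRIMITIVE (`IsUnit (f u)` for some `u`) with EXACT eigen-equations `T_g f = x v • f`.  This is the
  torsion-tolerant occupancy of `Lines/Sketch.lean` rev 5 in finite-level words: with
  `N := M/𝔭_x M` (`M` = completed homology, f.g. over the Noetherian `Λ⟦𝕋⟧`), primitive exact
  eigenforms of every depth ⟺ the Pontryagin dual of `N` has unbounded exponent ⟺ `N` is not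
  `p`-power torsion ⟺ `N[1/p] ≠ 0` ⟺ `Hom_cts(N, O) ≠ 0` ⟺ `Ŝ(U^p)_E[𝔭_x] ≠ 0`; a mere POINT only
  yields imprimitive (`p^{e-1}`-multiple) eigenvectors (TRIAGE-r1-2's `(ℤ/25)²` toy) — that gap IS S1.
* GK BOUND (output of S5, hypothesis of S1): the door's growth form at `𝔪_x̄`, `k = IsLocalRing.ResidueField O`:
  `∃ C, ∀ r κ (f : κ → QuaternionicForm D (U r) k)`, linearly independent and `𝔪_x̄`-torsion
  ⇒ `card κ ≤ C · p ^ (r · finrank ℚ F)`.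
* `e = 0` (zero ring) makes POINT/OCCUPANCY trivially true at that index only; no stub degenerates.

## Disproof used

`Cruxes/CrystallineProModularClassical/Disproof.lean` gen 1 cycle 1 (read in full).  §0
`crux_of_langlands`: no stub here strengthens the crux's CONCLUSION; S6 weakens the crux's hypothesis
side only by trading the point for an eigenvector, and is on paper implied by FM in the sector +
Emerton 2006 (locally algebraic vectors of `Ŝ` of the definite set ARE the classical forms).  §1b:
pro-modularity is load-bearing for the METHOD at a named step — S1 localises the Noether
normalisation at `𝔭_x`.  §1g: irreducibility enters S4 (an Eisenstein point need not transfer), S5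
(hypothesis `∃ ρ irreducible`), S6, and `stub_quadraticDescent` (restriction to `Γ_{F'}`).  §1h
(`WithoutCrystalline` false on paper): RESPECTED — S1 gives occupancy also for the non-de-Rham twist
family; crystallinity is consumed only in S6 (and transported by `stub_oddDegreeAscent`).  §1a: `hunr`
is passed through untouched (decoration).  §1d': the regularity conjunct travels with the crystalline
conjunct verbatim (the crux's `hloc` is copied, never split).  §4 `hpm_point_integral`: the reason
`x` is `O`-valued.  §5 HAZARD ("point of `𝕋(K^p)` ≠ occurrence"): this line IS the argument, on the
cuspidal definite tower (no boundary), and the passage from the all-degree `X_U`-tower to it is an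
explicit stub (S4) at the level of POINTS.  No `_false_without_` theorem exists (Disproof proves none
can short of `¬ Langlands`); no `-- Targets` kill; the landed `Negative.LoadBearing` lemmas
(`satakeConclusion_of_langlands`, jump-multiset lemmas) concern neither occupancy nor base change.
Door: `Cruxes/EisensteinGKBound/Disproof.lean` (`eisensteinGKBoundNondeg_holds`, level collapse of the
route decl `EisensteinGKBound`) — honoured by NOT importing the door by name and by typing every Hecke
condition with `g` supported at `v`.
-/

set_option linter.dupNamespace false
set_option linter.unusedVariables false
set_option maxHeartbeats 800000

namespace Summit.Langlands.Langlands.Cruxes.CrystallineProModularClassical.NoetherFlatOccupancy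

open scoped Classical
open Summit.Langlands.Langlands.Theses.EisensteinGelfandKirillov (CrystallineProModularClassical)

noncomputable section

/-! ## 1. Registered stubs (the ONLY `sorry`s of the file; each ONE closed statement over existing declarations) -/
/-- **Stub S4 (card S4/P1) — the DEFINITE CARRIER of a pro-modular point, even degree.**
`F` totally real of EVEN degree, `p ≥ 5` unramified in `F`, `O` the valuation ring of `ℚ̄_p`,
`ρ : Γ_F → GL₂(ℚ̄_p)` irreducible, totally odd, a.e. unramified and `p`-adically automorphic of some
tame level (a continuous `ℚ̄_p`-point of the all-degree big Hecke algebra `𝕋(K^p)` of `GL₂/F`).  THEN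
there are: a totally definite quaternion algebra `D = ℍ(a,b)_F` (`a b : 𝓞 F` non-zero, `p`-units)
split above `p`, a finite set `S ⊇ {v ∣ 2pab}` of places, a level tower `U(r) = U(0) ∩ (1 + p^r Ô)`
(`U(0) ≤ Ô^×` open and hyperspecial off `S`, Hecke pairs), and `x : v ↦ x v ∈ O` such that (POINT)
for every `e` some finite-level Hecke algebra `O[T_v : v ∉ S] ⊂ End_O S(U(r), O)` admits an
`O`-algebra map to `O/p^e` with `T_v ↦ x v`, and (TRACE) for `v ∉ S`, `ρ` is unramified at `v` with
`charpoly ρ(Frob_v) = X² − (x v) X + c_v`.  Why plausibly true: `D` unramified at all finite places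
exists since `[F:ℚ]` is even (Hasse), with `a, b` chosen `p`-adic units by weak approximation; at
finite level the cuspidal `GL₂`-eigensystems of trivial weight transfer by Jacquet–Langlands (Taylor
1989 §1; the tree's `JacquetLanglands*`), the constants carry `T_v ↦ q_v + 1`, and the remaining
boundary / torsion eigensystems of the `X_U`-tower are Eisenstein (reducible pseudo-characters) or
definite-quaternionic after raising the `p`-level, with Scholze's bounded nilpotence making the
comparison of closures exact on continuous points; irreducibility of `ρ` excludes the Eisenstein
factor.  NOT formal and not verbatim in print (it is the HAZARD of Disproof §5 made a stub, at the
level of points, not eigenvectors).  Size L.  [cite: Taylor1989, §1] [cite: Scholze2015, Thm. V.4.1 and Cor. V.4.2 (bounded nilpotence)]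
[cite: arXiv:1901.07166, §3]  -/
theorem stub_definiteCarrier : ∀ (F : Type) [Field F] [NumberField F], NumberField.IsTotallyReal F → Even (Module.finrank ℚ F) → ∀ (p : ℕ) [Fact p.Prime], 5 ≤ p → ¬ ((p : ℤ) ∣ NumberField.discr F) → ∀ (O : ValuationSubring (PadicAlgCl p)), O = (Valued.v : Valuation (PadicAlgCl p) NNReal).valuationSubring → ∀ (ρ : Literature.NumberTheory.GaloisRepresentations.FramedGaloisRep F (PadicAlgCl p) 2), ρ.toGaloisRep.IsIrreducible → ρ.IsOdd → (∀ᶠ v in Filter.cofinite, ρ.IsUnramifiedAt v) → (∃ 𝒰 : Literature.NumberTheory.Automorphic.BigHeckeGLn.TameLevel 2 F p, 𝒰.IsPadicallyAutomorphic ρ) → ∃ (a b : NumberField.RingOfIntegers F) (S : Finset (IsDedekindDomain.HeightOneSpectrum (NumberField.RingOfIntegers F))) (U : ℕ → Subgroup (Literature.NumberTheory.Automorphic.finiteAdelicUnits F (QuaternionAlgebra F (algebraMap (NumberField.RingOfIntegers F) F a) (0 : F) (algebraMap (NumberField.RingOfIntegers F) F b)))) (_ : ∀ r, IsHeckeTriple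 (⊤ : Submonoid (Literature.NumberTheory.Automorphic.finiteAdelicUnits F (QuaternionAlgebra F (algebraMap (NumberField.RingOfIntegers F) F a) (0 : F) (algebraMap (NumberField.RingOfIntegers F) F b)))) (U r) (U r)) (x : IsDedekindDomain.HeightOneSpectrum (NumberField.RingOfIntegers F) → ↥O), a ≠ 0 ∧ b ≠ 0 ∧ Literature.NumberTheory.Automorphic.IsTotallyDefinite F (QuaternionAlgebra F (algebraMap (NumberField.RingOfIntegers F) F a) (0 : F) (algebraMap (NumberField.RingOfIntegers F) F b)) ∧ (∀ v : IsDedekindDomain.HeightOneSpectrum (NumberField.RingOfIntegers F), (((p : ℕ) : NumberField.RingOfIntegers F)) ∈ v.asIdeal → Literature.NumberTheory.Automorphic.IsSplitAt (QuaternionAlgebra F (algebraMap (NumberField.RingOfIntegers F) F a) (0 : F) (algebraMap (NumberField.RingOfIntegers F) F b)) v ∧ a * b ∉ v.asIdeal) ∧ (∀ v : IsDedekindDomain.HeightOneSpectrum (NumberField.RingOfIntegers F), ((2 * p : ℕ) : NumberField.RingOfIntegers F) * a * b ∈ v.asIdeal → v ∈ S) ∧ (∀ (r : ℕ) (u : Literature.NumberTheory.Automorphic.finiteAdelicUnits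 F (QuaternionAlgebra F (algebraMap (NumberField.RingOfIntegers F) F a) (0 : F) (algebraMap (NumberField.RingOfIntegers F) F b))), u ∈ U r ↔ (u ∈ U 0 ∧ ∀ i : Fin 4, ∃ y ∈ Literature.NumberTheory.Automorphic.integralFiniteAdeles F, Literature.NumberTheory.Automorphic.QuaternionAlgebra.adelicCoords a b (↑u - 1) i = ↑(p ^ r) * y)) ∧ U 0 ≤ Literature.NumberTheory.Automorphic.QuaternionAlgebra.integralUnits a b ∧ IsOpen (U 0 : Set (Literature.NumberTheory.Automorphic.finiteAdelicUnits F (QuaternionAlgebra F (algebraMap (NumberField.RingOfIntegers F) F a) (0 : F) (algebraMap (NumberField.RingOfIntegers F) F b)))) ∧ (∀ v ∉ S, ∀ γ ∈ Literature.NumberTheory.Automorphic.QuaternionAlgebra.integralUnits a b, (∀ w : IsDedekindDomain.HeightOneSpectrum (NumberField.RingOfIntegers F), w ≠ v → ∀ i : Fin 4, (Literature.NumberTheory.Automorphic.QuaternionAlgebra.adelicCoords a b (↑γ - 1) i) w = 0) → γ ∈ U 0) ∧ (∀ e : ℕ, ∃ r : ℕ, ∃ φ : ↥(Algebra.adjoin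 ↥O {T : Module.End ↥O (Literature.NumberTheory.Automorphic.QuaternionicForm (QuaternionAlgebra F (algebraMap (NumberField.RingOfIntegers F) F a) (0 : F) (algebraMap (NumberField.RingOfIntegers F) F b)) (U r) ↥O) | ∃ v ∉ S, ∃ g : Literature.NumberTheory.Automorphic.finiteAdelicUnits F (QuaternionAlgebra F (algebraMap (NumberField.RingOfIntegers F) F a) (0 : F) (algebraMap (NumberField.RingOfIntegers F) F b)), (Literature.NumberTheory.Automorphic.QuaternionAlgebra.adelicEquiv a b ↑g ∈ Literature.NumberTheory.Automorphic.QuaternionAlgebra.adelicOrder a b ∧ (∀ w : IsDedekindDomain.HeightOneSpectrum (NumberField.RingOfIntegers F), w ≠ v → ∀ i : Fin 4, (Literature.NumberTheory.Automorphic.QuaternionAlgebra.adelicCoords a b (↑g - 1) i) w = 0) ∧ (∀ w : IsDedekindDomain.HeightOneSpectrum (NumberField.RingOfIntegers F), Valued.v (((Literature.NumberTheory.Automorphic.QuaternionAlgebra.adelicCoords a b ↑g 0 ^ 2 - algebraMap (NumberField.RingOfIntegers F) _ a * Literature.NumberTheory.Automorphic.QuaternionAlgebra.adelicCoords a b ↑g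 1 ^ 2 - algebraMap (NumberField.RingOfIntegers F) _ b * Literature.NumberTheory.Automorphic.QuaternionAlgebra.adelicCoords a b ↑g 2 ^ 2 + algebraMap (NumberField.RingOfIntegers F) _ a * algebraMap (NumberField.RingOfIntegers F) _ b * Literature.NumberTheory.Automorphic.QuaternionAlgebra.adelicCoords a b ↑g 3 ^ 2) : (IsDedekindDomain.FiniteAdeleRing (NumberField.RingOfIntegers F) F)) w) = if w = v then WithZero.exp (-1) else 1)) ∧ T = Literature.NumberTheory.Automorphic.QuaternionicForm.heckeOperator ↥O g}) →ₐ[↥O] (↥O ⧸ Ideal.span {(((p : ℕ) : ↥O)) ^ e}), ∀ v ∉ S, ∀ g : Literature.NumberTheory.Automorphic.finiteAdelicUnits F (QuaternionAlgebra F (algebraMap (NumberField.RingOfIntegers F) F a) (0 : F) (algebraMap (NumberField.RingOfIntegers F) F b)), (Literature.NumberTheory.Automorphic.QuaternionAlgebra.adelicEquiv a b ↑g ∈ Literature.NumberTheory.Automorphic.QuaternionAlgebra.adelicOrder a b ∧ (∀ w : IsDedekindDomain.HeightOneSpectrum (NumberField.RingOfIntegers F), w ≠ v → ∀ i : Fin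 4, (Literature.NumberTheory.Automorphic.QuaternionAlgebra.adelicCoords a b (↑g - 1) i) w = 0) ∧ (∀ w : IsDedekindDomain.HeightOneSpectrum (NumberField.RingOfIntegers F), Valued.v (((Literature.NumberTheory.Automorphic.QuaternionAlgebra.adelicCoords a b ↑g 0 ^ 2 - algebraMap (NumberField.RingOfIntegers F) _ a * Literature.NumberTheory.Automorphic.QuaternionAlgebra.adelicCoords a b ↑g 1 ^ 2 - algebraMap (NumberField.RingOfIntegers F) _ b * Literature.NumberTheory.Automorphic.QuaternionAlgebra.adelicCoords a b ↑g 2 ^ 2 + algebraMap (NumberField.RingOfIntegers F) _ a * algebraMap (NumberField.RingOfIntegers F) _ b * Literature.NumberTheory.Automorphic.QuaternionAlgebra.adelicCoords a b ↑g 3 ^ 2) : (IsDedekindDomain.FiniteAdeleRing (NumberField.RingOfIntegers F) F)) w) = if w = v then WithZero.exp (-1) else 1)) → ∃ T, φ T = Ideal.Quotient.mk (Ideal.span {(((p : ℕ) : ↥O)) ^ e}) (x v) ∧ (T : Module.End ↥O (Literature.NumberTheory.Automorphic.QuaternionicForm (QuaternionAlgebra F (algebraMap (NumberField.RingOfIntegers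 F) F a) (0 : F) (algebraMap (NumberField.RingOfIntegers F) F b)) (U r) ↥O)) = Literature.NumberTheory.Automorphic.QuaternionicForm.heckeOperator ↥O g) ∧ (∀ v ∉ S, ρ.IsUnramifiedAt v ∧ ∃ c : PadicAlgCl p, ρ.HasFrobCharpolyAt v (Polynomial.X ^ 2 - Polynomial.C ((x v : ↥O) : PadicAlgCl p) * Polynomial.X + Polynomial.C c)) := by
  sorry

/-- **Stub S5 (card S5 = DOOR⁺) — the Gelfand–Kirillov bound AT THE MAXIMAL IDEAL OF THE POINT.**
For a tower datum `(D = ℍ(a,b)_F, S, U)` as in `stub_definiteCarrier` over a totally real `F` of even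
degree (`p ≥ 5` unramified, `D` totally definite, split above `p`) and an `O`-point `x` (POINT) whose
`T_v`-eigenvalues are the Frobenius traces of SOME irreducible odd `ρ`: there is `C` with
`dim_k S(U(r), k)[𝔪_x̄] ≤ C · p^(r[F:ℚ])` for all `r`, where `k` is the residue field of `O`, `𝔪_x̄` is
cut out by the exact eigen-equations `T_g f = x̄ v • f` for every Hecke element `g` SUPPORTED at a
place `v ∉ S` (so `T_g = T_v`; the level-collapse of the route's door does not occur), i.e. the
smooth `∏_{v∣p} GL₂(F_v)`-representation `lim_r S(U(r),k)[𝔪_x̄]` has GK-dimension `≤ Σ_{v∣p}[F_v:ℚ_p]`.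
Why plausibly true: EQUAL to `[F_v:ℚ_p]` per place at non-Eisenstein GENERIC `𝔪` under Taylor–Wiles
hypotheses (Breuil–Herzig–Hu–Morra–Schraen arXiv:2009.03127 Thm 1.1, Hu–Wang arXiv:2009.09640; inner
forms Dotto–Le Hung arXiv:2604.15164); expected in general (Gee–Newton arXiv:1609.06965 §1: the
codimension inequality); at the route's Eisenstein `p`-distinguished `𝔪` it is the route's own door
re-typed (crux idea `eisenstein-door-supported-hecke` on stmt-Langlands-18272, BHHMS Thm 1.6 local
criterion).  OPEN in print at Eisenstein and at non-generic `𝔪` — the route's bet, here at the `𝔪`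
of the point (triage r2-1 sharpen (2)).  Cheapest falsifier = the route's K1 Brandt-module count
(F = ℚ(√5), p = 7 inert, r = 1).  Size XL.  [cite: BreuilEtAl2023, Thm 1.1 and Thm 1.6]
[cite: HuWang2020] [cite: GeeNewton2020, §1] -/
theorem stub_gkBoundAtPoint : ∀ (F : Type) [Field F] [NumberField F], NumberField.IsTotallyReal F → Even (Module.finrank ℚ F) → ∀ (p : ℕ) [Fact p.Prime], 5 ≤ p → ¬ ((p : ℤ) ∣ NumberField.discr F) → ∀ (O : ValuationSubring (PadicAlgCl p)), O = (Valued.v : Valuation (PadicAlgCl p) NNReal).valuationSubring → ∀ (a b : NumberField.RingOfIntegers F), a ≠ 0 → b ≠ 0 → Literature.NumberTheory.Automorphic.IsTotallyDefinite F (QuaternionAlgebra F (algebraMap (NumberField.RingOfIntegers F) F a) (0 : F) (algebraMap (NumberField.RingOfIntegers F) F b)) → (∀ v : IsDedekindDomain.HeightOneSpectrum (NumberField.RingOfIntegers F), (((p : ℕ) : NumberField.RingOfIntegers F)) ∈ v.asIdeal → Literature.NumberTheory.Automorphic.IsSplitAt (QuaternionAlgebra F (algebraMap (NumberField.RingOfIntegers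 F) F a) (0 : F) (algebraMap (NumberField.RingOfIntegers F) F b)) v ∧ a * b ∉ v.asIdeal) → ∀ (S : Finset (IsDedekindDomain.HeightOneSpectrum (NumberField.RingOfIntegers F))), (∀ v : IsDedekindDomain.HeightOneSpectrum (NumberField.RingOfIntegers F), ((2 * p : ℕ) : NumberField.RingOfIntegers F) * a * b ∈ v.asIdeal → v ∈ S) → ∀ (U : ℕ → Subgroup (Literature.NumberTheory.Automorphic.finiteAdelicUnits F (QuaternionAlgebra F (algebraMap (NumberField.RingOfIntegers F) F a) (0 : F) (algebraMap (NumberField.RingOfIntegers F) F b)))) [∀ r, IsHeckeTriple (⊤ : Submonoid (Literature.NumberTheory.Automorphic.finiteAdelicUnits F (QuaternionAlgebra F (algebraMap (NumberField.RingOfIntegers F) F a) (0 : F) (algebraMap (NumberField.RingOfIntegers F) F b)))) (U r) (U r)], (∀ (r : ℕ) (u : Literature.NumberTheory.Automorphic.finiteAdelicUnits F (QuaternionAlgebra F (algebraMap (NumberField.RingOfIntegers F) F a) (0 : F) (algebraMap (NumberField.RingOfIntegers F) F b))), u ∈ U r ↔ (u ∈ U 0 ∧ ∀ i : Fin 4,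 ∃ y ∈ Literature.NumberTheory.Automorphic.integralFiniteAdeles F, Literature.NumberTheory.Automorphic.QuaternionAlgebra.adelicCoords a b (↑u - 1) i = ↑(p ^ r) * y)) → U 0 ≤ Literature.NumberTheory.Automorphic.QuaternionAlgebra.integralUnits a b → IsOpen (U 0 : Set (Literature.NumberTheory.Automorphic.finiteAdelicUnits F (QuaternionAlgebra F (algebraMap (NumberField.RingOfIntegers F) F a) (0 : F) (algebraMap (NumberField.RingOfIntegers F) F b)))) → (∀ v ∉ S, ∀ γ ∈ Literature.NumberTheory.Automorphic.QuaternionAlgebra.integralUnits a b, (∀ w : IsDedekindDomain.HeightOneSpectrum (NumberField.RingOfIntegers F), w ≠ v → ∀ i : Fin 4, (Literature.NumberTheory.Automorphic.QuaternionAlgebra.adelicCoords a b (↑γ - 1) i) w = 0) → γ ∈ U 0) → ∀ (x : IsDedekindDomain.HeightOneSpectrum (NumberField.RingOfIntegers F) → ↥O), (∀ e : ℕ, ∃ r : ℕ, ∃ φ : ↥(Algebra.adjoin ↥O {T : Module.End ↥O (Literature.NumberTheory.Automorphic.QuaternionicForm (QuaternionAlgebra F (algebraMap (NumberField.RingOfIntegers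 F) F a) (0 : F) (algebraMap (NumberField.RingOfIntegers F) F b)) (U r) ↥O) | ∃ v ∉ S, ∃ g : Literature.NumberTheory.Automorphic.finiteAdelicUnits F (QuaternionAlgebra F (algebraMap (NumberField.RingOfIntegers F) F a) (0 : F) (algebraMap (NumberField.RingOfIntegers F) F b)), (Literature.NumberTheory.Automorphic.QuaternionAlgebra.adelicEquiv a b ↑g ∈ Literature.NumberTheory.Automorphic.QuaternionAlgebra.adelicOrder a b ∧ (∀ w : IsDedekindDomain.HeightOneSpectrum (NumberField.RingOfIntegers F), w ≠ v → ∀ i : Fin 4, (Literature.NumberTheory.Automorphic.QuaternionAlgebra.adelicCoords a b (↑g - 1) i) w = 0) ∧ (∀ w : IsDedekindDomain.HeightOneSpectrum (NumberField.RingOfIntegers F), Valued.v (((Literature.NumberTheory.Automorphic.QuaternionAlgebra.adelicCoords a b ↑g 0 ^ 2 - algebraMap (NumberField.RingOfIntegers F) _ a * Literature.NumberTheory.Automorphic.QuaternionAlgebra.adelicCoords a b ↑g 1 ^ 2 - algebraMap (NumberField.RingOfIntegers F) _ b * Literature.NumberTheory.Automorphic.QuaternionAlgebra.adelicCoords a b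 ↑g 2 ^ 2 + algebraMap (NumberField.RingOfIntegers F) _ a * algebraMap (NumberField.RingOfIntegers F) _ b * Literature.NumberTheory.Automorphic.QuaternionAlgebra.adelicCoords a b ↑g 3 ^ 2) : (IsDedekindDomain.FiniteAdeleRing (NumberField.RingOfIntegers F) F)) w) = if w = v then WithZero.exp (-1) else 1)) ∧ T = Literature.NumberTheory.Automorphic.QuaternionicForm.heckeOperator ↥O g}) →ₐ[↥O] (↥O ⧸ Ideal.span {(((p : ℕ) : ↥O)) ^ e}), ∀ v ∉ S, ∀ g : Literature.NumberTheory.Automorphic.finiteAdelicUnits F (QuaternionAlgebra F (algebraMap (NumberField.RingOfIntegers F) F a) (0 : F) (algebraMap (NumberField.RingOfIntegers F) F b)), (Literature.NumberTheory.Automorphic.QuaternionAlgebra.adelicEquiv a b ↑g ∈ Literature.NumberTheory.Automorphic.QuaternionAlgebra.adelicOrder a b ∧ (∀ w : IsDedekindDomain.HeightOneSpectrum (NumberField.RingOfIntegers F), w ≠ v → ∀ i : Fin 4, (Literature.NumberTheory.Automorphic.QuaternionAlgebra.adelicCoords a b (↑g - 1) i) w = 0) ∧ (∀ w : IsDedekindDomain.HeightOneSpectrum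 (NumberField.RingOfIntegers F), Valued.v (((Literature.NumberTheory.Automorphic.QuaternionAlgebra.adelicCoords a b ↑g 0 ^ 2 - algebraMap (NumberField.RingOfIntegers F) _ a * Literature.NumberTheory.Automorphic.QuaternionAlgebra.adelicCoords a b ↑g 1 ^ 2 - algebraMap (NumberField.RingOfIntegers F) _ b * Literature.NumberTheory.Automorphic.QuaternionAlgebra.adelicCoords a b ↑g 2 ^ 2 + algebraMap (NumberField.RingOfIntegers F) _ a * algebraMap (NumberField.RingOfIntegers F) _ b * Literature.NumberTheory.Automorphic.QuaternionAlgebra.adelicCoords a b ↑g 3 ^ 2) : (IsDedekindDomain.FiniteAdeleRing (NumberField.RingOfIntegers F) F)) w) = if w = v then WithZero.exp (-1) else 1)) → ∃ T, φ T = Ideal.Quotient.mk (Ideal.span {(((p : ℕ) : ↥O)) ^ e}) (x v) ∧ (T : Module.End ↥O (Literature.NumberTheory.Automorphic.QuaternionicForm (QuaternionAlgebra F (algebraMap (NumberField.RingOfIntegers F) F a) (0 : F) (algebraMap (NumberField.RingOfIntegers F) F b)) (U r) ↥O)) = Literature.NumberTheory.Automorphic.QuaternionicForm.heckeOperator ↥O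 g) → (∃ (ρ : Literature.NumberTheory.GaloisRepresentations.FramedGaloisRep F (PadicAlgCl p) 2), ρ.toGaloisRep.IsIrreducible ∧ ρ.IsOdd ∧ (∀ v ∉ S, ρ.IsUnramifiedAt v ∧ ∃ c : PadicAlgCl p, ρ.HasFrobCharpolyAt v (Polynomial.X ^ 2 - Polynomial.C ((x v : ↥O) : PadicAlgCl p) * Polynomial.X + Polynomial.C c))) → (∃ C : ℝ, ∀ (r : ℕ) (κ : Type) [Fintype κ] (f : κ → Literature.NumberTheory.Automorphic.QuaternionicForm (QuaternionAlgebra F (algebraMap (NumberField.RingOfIntegers F) F a) (0 : F) (algebraMap (NumberField.RingOfIntegers F) F b)) (U r) (IsLocalRing.ResidueField ↥O)), LinearIndependent (IsLocalRing.ResidueField ↥O) f → (∀ j, ∀ v ∉ S, ∀ g : Literature.NumberTheory.Automorphic.finiteAdelicUnits F (QuaternionAlgebra F (algebraMap (NumberField.RingOfIntegers F) F a) (0 : F) (algebraMap (NumberField.RingOfIntegers F) F b)), (Literature.NumberTheory.Automorphic.QuaternionAlgebra.adelicEquiv a b ↑g ∈ Literature.NumberTheory.Automorphic.QuaternionAlgebra.adelicOrder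 a b ∧ (∀ w : IsDedekindDomain.HeightOneSpectrum (NumberField.RingOfIntegers F), w ≠ v → ∀ i : Fin 4, (Literature.NumberTheory.Automorphic.QuaternionAlgebra.adelicCoords a b (↑g - 1) i) w = 0) ∧ (∀ w : IsDedekindDomain.HeightOneSpectrum (NumberField.RingOfIntegers F), Valued.v (((Literature.NumberTheory.Automorphic.QuaternionAlgebra.adelicCoords a b ↑g 0 ^ 2 - algebraMap (NumberField.RingOfIntegers F) _ a * Literature.NumberTheory.Automorphic.QuaternionAlgebra.adelicCoords a b ↑g 1 ^ 2 - algebraMap (NumberField.RingOfIntegers F) _ b * Literature.NumberTheory.Automorphic.QuaternionAlgebra.adelicCoords a b ↑g 2 ^ 2 + algebraMap (NumberField.RingOfIntegers F) _ a * algebraMap (NumberField.RingOfIntegers F) _ b * Literature.NumberTheory.Automorphic.QuaternionAlgebra.adelicCoords a b ↑g 3 ^ 2) : (IsDedekindDomain.FiniteAdeleRing (NumberField.RingOfIntegers F) F)) w) = if w = v then WithZero.exp (-1) else 1)) → Literature.NumberTheory.Automorphic.QuaternionicForm.heckeOperator (IsLocalRing.ResidueField ↥O) g (f j) = (IsLocalRing.residue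 ↥O (x v)) • f j) → (Fintype.card κ : ℝ) ≤ C * (p : ℝ) ^ (r * Module.finrank ℚ F)) := by
  sorry

/-- **Stub S1 (card S1 = THE NEW ALGEBRA; load-bearing; attack first) — NOETHER-FLAT OCCUPANCY.**
For a tower datum `(D, S, U)` over a totally real `F` of even degree (`p ≥ 5` unramified, `D = ℍ(a,b)_F`
totally definite split above `p`), an `O`-point `x` (POINT) and the GK bound at `𝔪_x̄` (conclusion of
`stub_gkBoundAtPoint`): the point is OCCUPIED — for every `e` there are a level `r` and a PRIMITIVE
form `f ∈ S(U(r), O/p^e)` (some value a unit) with EXACT eigen-equations `T_g f = x v • f` for every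
Hecke element `g` supported at every `v ∉ S`.  (⟺ `Ŝ(U^p)_E[𝔭_x] ≠ 0`, module docstring.)  Intended
proof (card (A)–(D), NOTES-ideator4-r2; the triage's S1a/S1b cut lives INSIDE, on completed objects the
tree does not have): with `M` = `𝔪`-adic completed homology of the tower (FREE over `Λ = O'⟦K₁⟧`,
`K₁ = U(1)_p` uniform pro-`p` — Pan arXiv:1901.07166 §3, the freeness statement the card cites as
Prop. (chproj); non-neat `U(0)` via a prime-to-`p` normal shrink) and `𝕋 = 𝕋^D(U^p)_𝔪` (Noetherian: quotient of the pseudo-deformation ring):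
(A) `dim 𝕋 = 1 + 2[F:ℚ]` — `≥` from the GK bound by Pan's "total ≤ base + fibre" (§3.6, proof of Thm
(dh)), `≤` from Newton–Thorne arXiv:1912.11265 Thm 2 (`H¹_f(ad) = 0` at one non-CM classical point of
each component; classical points are Zariski-dense in every component of the REDUCED definite Hecke
algebra) + Poitou–Tate + purity; (B) over a Noether normalisation `A = O'⟦u₁,…,u_{2d}⟧ ⊂ 𝕋` with
`uᵢ ∈ 𝔭_x` (prime avoidance), `M = B^h/(uᵢ − Gᵢ)` is perfect of grade `2d` over the Auslander-regular
`B = A⟦K₁⟧`, hence pure, and the GK bound forces every `uᵢ` to drop the canonical dimension, so `(u)`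
is `M`-regular and `M` is `A`-FLAT — Gee–Newton's miracle flatness arXiv:1609.06965 App. Prop. 26 run
over a regular SUBRING (no surjection `R_∞ ↠ 𝕋`, no Taylor–Wiles primes); (C) SATURATION DESCENT:
replacing `𝕋` by its `A`-saturation in `End_B(M)` at each of the `2d` regular quotients keeps the
action faithful; the saturation stays integral over `A` ("saturation-integrality lemma": height-one
localisation + Krull ∩ + flatness, TRIAGE-r2-2) — the first NEW checkable statement, to be landed
`--supports stmt-Langlands-18274`; (D) the end is a finite flat `O'`-algebra acting faithfully on the
flat part of `M/(u)M ≠ 0`, whose point `x` therefore has a non-torsion eigenvector (Artinian Nakayama;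
tree: `Literature.NumberTheory.Automorphic.exists_ne_zero_forall_apply_eq_smul_of_algHom`).  Why it
might fail: a gap in (C) for `dim A ≥ 2`, or purity failing for `K₁` with torsion (take `K₁ = 1 + pM₂`,
uniform).  Cheapest falsifier: the smallest non-commutative instance (`K₁ = (1 + pM₂(ℤ_p))/centre`,
`h = 2`, two commuting topologically nilpotent `Gᵢ`).  Size L/XL.  [cite: GeeNewton2020, App. Prop. 26]
[cite: arXiv:1901.07166, §3.6] [cite: arXiv:1912.11265, Thm 2] -/
theorem stub_noetherFlatOccupancy : ∀ (F : Type) [Field F] [NumberField F], NumberField.IsTotallyReal F → Even (Module.finrank ℚ F) → ∀ (p : ℕ) [Fact p.Prime], 5 ≤ p → ¬ ((p : ℤ) ∣ NumberField.discr F) → ∀ (O : ValuationSubring (PadicAlgCl p)), O = (Valued.v : Valuation (PadicAlgCl p) NNReal).valuationSubring → ∀ (a b : NumberField.RingOfIntegers F), a ≠ 0 → b ≠ 0 → Literature.NumberTheory.Automorphic.IsTotallyDefinite F (QuaternionAlgebra F (algebraMap (NumberField.RingOfIntegers F) F a) (0 : F) (algebraMap (NumberField.RingOfIntegers F) F b))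 → (∀ v : IsDedekindDomain.HeightOneSpectrum (NumberField.RingOfIntegers F), (((p : ℕ) : NumberField.RingOfIntegers F)) ∈ v.asIdeal → Literature.NumberTheory.Automorphic.IsSplitAt (QuaternionAlgebra F (algebraMap (NumberField.RingOfIntegers F) F a) (0 : F) (algebraMap (NumberField.RingOfIntegers F) F b)) v ∧ a * b ∉ v.asIdeal) → ∀ (S : Finset (IsDedekindDomain.HeightOneSpectrum (NumberField.RingOfIntegers F))), (∀ v : IsDedekindDomain.HeightOneSpectrum (NumberField.RingOfIntegers F), ((2 * p : ℕ) : NumberField.RingOfIntegers F) * a * b ∈ v.asIdeal → v ∈ S) → ∀ (U : ℕ → Subgroup (Literature.NumberTheory.Automorphic.finiteAdelicUnits F (QuaternionAlgebra F (algebraMap (NumberField.RingOfIntegers F) F a) (0 : F) (algebraMap (NumberField.RingOfIntegers F) F b)))) [∀ r, IsHeckeTriple (⊤ : Submonoid (Literature.NumberTheory.Automorphic.finiteAdelicUnits F (QuaternionAlgebra F (algebraMap (NumberField.RingOfIntegers F) F a) (0 : F) (algebraMap (NumberField.RingOfIntegers F) F b)))) (U r) (U r)], (∀ (r : ℕ)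 (u : Literature.NumberTheory.Automorphic.finiteAdelicUnits F (QuaternionAlgebra F (algebraMap (NumberField.RingOfIntegers F) F a) (0 : F) (algebraMap (NumberField.RingOfIntegers F) F b))), u ∈ U r ↔ (u ∈ U 0 ∧ ∀ i : Fin 4, ∃ y ∈ Literature.NumberTheory.Automorphic.integralFiniteAdeles F, Literature.NumberTheory.Automorphic.QuaternionAlgebra.adelicCoords a b (↑u - 1) i = ↑(p ^ r) * y)) → U 0 ≤ Literature.NumberTheory.Automorphic.QuaternionAlgebra.integralUnits a b → IsOpen (U 0 : Set (Literature.NumberTheory.Automorphic.finiteAdelicUnits F (QuaternionAlgebra F (algebraMap (NumberField.RingOfIntegers F) F a) (0 : F) (algebraMap (NumberField.RingOfIntegers F) F b)))) → (∀ v ∉ S, ∀ γ ∈ Literature.NumberTheory.Automorphic.QuaternionAlgebra.integralUnits a b, (∀ w : IsDedekindDomain.HeightOneSpectrum (NumberField.RingOfIntegers F), w ≠ v → ∀ i : Fin 4, (Literature.NumberTheory.Automorphic.QuaternionAlgebra.adelicCoords a b (↑γ - 1) i) w = 0) → γ ∈ U 0) → ∀ (x : IsDedekindDomain.HeightOneSpectrum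 (NumberField.RingOfIntegers F) → ↥O), (∀ e : ℕ, ∃ r : ℕ, ∃ φ : ↥(Algebra.adjoin ↥O {T : Module.End ↥O (Literature.NumberTheory.Automorphic.QuaternionicForm (QuaternionAlgebra F (algebraMap (NumberField.RingOfIntegers F) F a) (0 : F) (algebraMap (NumberField.RingOfIntegers F) F b)) (U r) ↥O) | ∃ v ∉ S, ∃ g : Literature.NumberTheory.Automorphic.finiteAdelicUnits F (QuaternionAlgebra F (algebraMap (NumberField.RingOfIntegers F) F a) (0 : F) (algebraMap (NumberField.RingOfIntegers F) F b)), (Literature.NumberTheory.Automorphic.QuaternionAlgebra.adelicEquiv a b ↑g ∈ Literature.NumberTheory.Automorphic.QuaternionAlgebra.adelicOrder a b ∧ (∀ w : IsDedekindDomain.HeightOneSpectrum (NumberField.RingOfIntegers F), w ≠ v → ∀ i : Fin 4, (Literature.NumberTheory.Automorphic.QuaternionAlgebra.adelicCoords a b (↑g - 1) i) w = 0) ∧ (∀ w : IsDedekindDomain.HeightOneSpectrum (NumberField.RingOfIntegers F), Valued.v (((Literature.NumberTheory.Automorphic.QuaternionAlgebra.adelicCoords a b ↑g 0 ^ 2 -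 algebraMap (NumberField.RingOfIntegers F) _ a * Literature.NumberTheory.Automorphic.QuaternionAlgebra.adelicCoords a b ↑g 1 ^ 2 - algebraMap (NumberField.RingOfIntegers F) _ b * Literature.NumberTheory.Automorphic.QuaternionAlgebra.adelicCoords a b ↑g 2 ^ 2 + algebraMap (NumberField.RingOfIntegers F) _ a * algebraMap (NumberField.RingOfIntegers F) _ b * Literature.NumberTheory.Automorphic.QuaternionAlgebra.adelicCoords a b ↑g 3 ^ 2) : (IsDedekindDomain.FiniteAdeleRing (NumberField.RingOfIntegers F) F)) w) = if w = v then WithZero.exp (-1) else 1)) ∧ T = Literature.NumberTheory.Automorphic.QuaternionicForm.heckeOperator ↥O g}) →ₐ[↥O] (↥O ⧸ Ideal.span {(((p : ℕ) : ↥O)) ^ e}), ∀ v ∉ S, ∀ g : Literature.NumberTheory.Automorphic.finiteAdelicUnits F (QuaternionAlgebra F (algebraMap (NumberField.RingOfIntegers F) F a) (0 : F) (algebraMap (NumberField.RingOfIntegers F) F b)), (Literature.NumberTheory.Automorphic.QuaternionAlgebra.adelicEquiv a b ↑g ∈ Literature.NumberTheory.Automorphic.QuaternionAlgebra.adelicOrder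 a b ∧ (∀ w : IsDedekindDomain.HeightOneSpectrum (NumberField.RingOfIntegers F), w ≠ v → ∀ i : Fin 4, (Literature.NumberTheory.Automorphic.QuaternionAlgebra.adelicCoords a b (↑g - 1) i) w = 0) ∧ (∀ w : IsDedekindDomain.HeightOneSpectrum (NumberField.RingOfIntegers F), Valued.v (((Literature.NumberTheory.Automorphic.QuaternionAlgebra.adelicCoords a b ↑g 0 ^ 2 - algebraMap (NumberField.RingOfIntegers F) _ a * Literature.NumberTheory.Automorphic.QuaternionAlgebra.adelicCoords a b ↑g 1 ^ 2 - algebraMap (NumberField.RingOfIntegers F) _ b * Literature.NumberTheory.Automorphic.QuaternionAlgebra.adelicCoords a b ↑g 2 ^ 2 + algebraMap (NumberField.RingOfIntegers F) _ a * algebraMap (NumberField.RingOfIntegers F) _ b * Literature.NumberTheory.Automorphic.QuaternionAlgebra.adelicCoords a b ↑g 3 ^ 2) : (IsDedekindDomain.FiniteAdeleRing (NumberField.RingOfIntegers F) F)) w) = if w = v then WithZero.exp (-1) else 1)) → ∃ T, φ T = Ideal.Quotient.mk (Ideal.span {(((p : ℕ) : ↥O)) ^ e}) (x v) ∧ (T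 : Module.End ↥O (Literature.NumberTheory.Automorphic.QuaternionicForm (QuaternionAlgebra F (algebraMap (NumberField.RingOfIntegers F) F a) (0 : F) (algebraMap (NumberField.RingOfIntegers F) F b)) (U r) ↥O)) = Literature.NumberTheory.Automorphic.QuaternionicForm.heckeOperator ↥O g) → (∃ C : ℝ, ∀ (r : ℕ) (κ : Type) [Fintype κ] (f : κ → Literature.NumberTheory.Automorphic.QuaternionicForm (QuaternionAlgebra F (algebraMap (NumberField.RingOfIntegers F) F a) (0 : F) (algebraMap (NumberField.RingOfIntegers F) F b)) (U r) (IsLocalRing.ResidueField ↥O)), LinearIndependent (IsLocalRing.ResidueField ↥O) f → (∀ j, ∀ v ∉ S, ∀ g : Literature.NumberTheory.Automorphic.finiteAdelicUnits F (QuaternionAlgebra F (algebraMap (NumberField.RingOfIntegers F) F a) (0 : F) (algebraMap (NumberField.RingOfIntegers F) F b)), (Literature.NumberTheory.Automorphic.QuaternionAlgebra.adelicEquiv a b ↑g ∈ Literature.NumberTheory.Automorphic.QuaternionAlgebra.adelicOrder a b ∧ (∀ w : IsDedekindDomain.HeightOneSpectrum (NumberField.RingOfIntegers F), w ≠ v →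 ∀ i : Fin 4, (Literature.NumberTheory.Automorphic.QuaternionAlgebra.adelicCoords a b (↑g - 1) i) w = 0) ∧ (∀ w : IsDedekindDomain.HeightOneSpectrum (NumberField.RingOfIntegers F), Valued.v (((Literature.NumberTheory.Automorphic.QuaternionAlgebra.adelicCoords a b ↑g 0 ^ 2 - algebraMap (NumberField.RingOfIntegers F) _ a * Literature.NumberTheory.Automorphic.QuaternionAlgebra.adelicCoords a b ↑g 1 ^ 2 - algebraMap (NumberField.RingOfIntegers F) _ b * Literature.NumberTheory.Automorphic.QuaternionAlgebra.adelicCoords a b ↑g 2 ^ 2 + algebraMap (NumberField.RingOfIntegers F) _ a * algebraMap (NumberField.RingOfIntegers F) _ b * Literature.NumberTheory.Automorphic.QuaternionAlgebra.adelicCoords a b ↑g 3 ^ 2) : (IsDedekindDomain.FiniteAdeleRing (NumberField.RingOfIntegers F) F)) w) = if w = v then WithZero.exp (-1) else 1)) → Literature.NumberTheory.Automorphic.QuaternionicForm.heckeOperator (IsLocalRing.ResidueField ↥O) g (f j) = (IsLocalRing.residue ↥O (x v)) • f j) → (Fintype.card κ : ℝ) ≤ C * (p : ℝ) ^ (r *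 Module.finrank ℚ F)) → (∀ e : ℕ, ∃ r : ℕ, ∃ f : Literature.NumberTheory.Automorphic.QuaternionicForm (QuaternionAlgebra F (algebraMap (NumberField.RingOfIntegers F) F a) (0 : F) (algebraMap (NumberField.RingOfIntegers F) F b)) (U r) (↥O ⧸ Ideal.span {(((p : ℕ) : ↥O)) ^ e}), (∃ u : Literature.NumberTheory.Automorphic.finiteAdelicUnits F (QuaternionAlgebra F (algebraMap (NumberField.RingOfIntegers F) F a) (0 : F) (algebraMap (NumberField.RingOfIntegers F) F b)), IsUnit (f u)) ∧ ∀ v ∉ S, ∀ g : Literature.NumberTheory.Automorphic.finiteAdelicUnits F (QuaternionAlgebra F (algebraMap (NumberField.RingOfIntegers F) F a) (0 : F) (algebraMap (NumberField.RingOfIntegers F) F b)), (Literature.NumberTheory.Automorphic.QuaternionAlgebra.adelicEquiv a b ↑g ∈ Literature.NumberTheory.Automorphic.QuaternionAlgebra.adelicOrder a b ∧ (∀ w : IsDedekindDomain.HeightOneSpectrum (NumberField.RingOfIntegers F), w ≠ v → ∀ i : Fin 4, (Literature.NumberTheory.Automorphic.QuaternionAlgebra.adelicCoords a b (↑g - 1)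 i) w = 0) ∧ (∀ w : IsDedekindDomain.HeightOneSpectrum (NumberField.RingOfIntegers F), Valued.v (((Literature.NumberTheory.Automorphic.QuaternionAlgebra.adelicCoords a b ↑g 0 ^ 2 - algebraMap (NumberField.RingOfIntegers F) _ a * Literature.NumberTheory.Automorphic.QuaternionAlgebra.adelicCoords a b ↑g 1 ^ 2 - algebraMap (NumberField.RingOfIntegers F) _ b * Literature.NumberTheory.Automorphic.QuaternionAlgebra.adelicCoords a b ↑g 2 ^ 2 + algebraMap (NumberField.RingOfIntegers F) _ a * algebraMap (NumberField.RingOfIntegers F) _ b * Literature.NumberTheory.Automorphic.QuaternionAlgebra.adelicCoords a b ↑g 3 ^ 2) : (IsDedekindDomain.FiniteAdeleRing (NumberField.RingOfIntegers F) F)) w) = if w = v then WithZero.exp (-1) else 1)) → Literature.NumberTheory.Automorphic.QuaternionicForm.heckeOperator (↥O ⧸ Ideal.span {(((p : ℕ) : ↥O)) ^ e}) g f = (Ideal.Quotient.mk (Ideal.span {(((p : ℕ) : ↥O)) ^ e}) (x v)) • f) := by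
  sorry

/-- **Stub S6 (card S6 = OCC-EXIT; hardest; the crux's open content, now fed an EIGENVECTOR) —
CLASSICALITY OF AN OCCUPIED CRYSTALLINE POINT.**  `F` totally real of even degree, `p ≥ 5` unramified,
`ρ : Γ_F → GL₂(ℚ̄_p)` irreducible and totally odd; a tower datum `(D = ℍ(a,b)_F, S, U)` and
`x : v ↦ x v ∈ O` with `tr ρ(Frob_v) = x v`, `ρ` unramified, for `v ∉ S`; `x` OCCUPIED (primitive exact
eigenforms modulo every `p^e`, i.e. `Π_x := Ŝ(U^p)_E[𝔭_x] ≠ 0`, an admissible unitary Banach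
representation of `∏_{v∣p} GL₂(F_v)`); `ρ` crystalline with pairwise distinct labelled Hodge–Tate
weights at every `v ∣ p` (the crux's `hloc` verbatim).  THEN `ρ` is modular: an L-algebraic cuspidal
`π` on `GL₂(𝔸_F)` with a REGULAR L-algebraic infinity type and Satake–Frobenius matching at almost all
places.  On the definite tower "classical of weight `W`" is "`Π_x` has non-zero locally `W`-algebraic
vectors" (Emerton, Invent. Math. 164 (2006) §2–3: for a group compact at infinity modulo centre the
`W`-locally algebraic vectors of `Ŝ(U^p)` are `lim_{U_p} S_W(U^pU_p) ⊗ W^∨`, exactly, in degree `0`),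
then Jacquet–Langlands to `GL₂` and the Eichler–Shimura/Taylor dictionary for Satake parameters.
Intended proof = the ITEM's: Emerton's locally analytic Jacquet module `J_B(Π_x^{la}) ≠ 0` (finite
slope: a point of Buzzard's eigenvariety of `D^×`), crystalline ⇒ the refinement is of cohomological
weight, small-slope / companion-form classicality for overconvergent definite quaternionic forms.
Why it might fail = the item's: `J_B ≠ 0` for `F_v ≠ ℚ_p` is known only under Taylor–Wiles
hypotheses (Breuil–Ding, "Sur un problème de compatibilité local-global localement analytique", Mem.
AMS), nothing at Eisenstein `𝔪`; infinite slope would break a finite-slope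
route; critical slopes need companions.  OPEN IN PRINT for `[F_v:ℚ_p] ≥ 2` (it is the
"locally algebraic vectors" direction of `p`-adic local–global compatibility); the `F = ℚ`-analogue
is Emerton 2011 / Pan II.  Foreseen split (tenure): S6 ⇐ FiniteSlopeOfOccupiedCrystalline →
ClassicalOfFiniteSlope.  Size XL.  [cite: Emerton2006, §2–3 and Thm 0.3] [cite: Emerton2011LocalGlobal]
[cite: Taylor1989] (Buzzard, "Eigenvarieties", 2007, Part III: definite quaternion algebras over totally
real fields; Chenevier 2004/2011 for small-slope classicality on definite groups) -/
theorem stub_exitFromOccupancy : ∀ (F : Type) [Field F] [NumberField F], NumberField.IsTotallyReal F → Even (Module.finrank ℚ F) → ∀ (p : ℕ) [Fact p.Prime], 5 ≤ p → ¬ ((p : ℤ) ∣ NumberField.discr F) → ∀ (O : ValuationSubring (PadicAlgCl p)), O = (Valued.v : Valuation (PadicAlgCl p) NNReal).valuationSubring → ∀ (hcpt : Literature.NumberTheory.Automorphic.isCompact_glFiniteIntegralLevel 2 F) (ι : PadicAlgCl p ≃+* ℂ) (ρ : Literature.NumberTheory.GaloisRepresentations.FramedGaloisRep F (PadicAlgCl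 p) 2), ρ.toGaloisRep.IsIrreducible → ρ.IsOdd → ∀ (a b : NumberField.RingOfIntegers F), a ≠ 0 → b ≠ 0 → Literature.NumberTheory.Automorphic.IsTotallyDefinite F (QuaternionAlgebra F (algebraMap (NumberField.RingOfIntegers F) F a) (0 : F) (algebraMap (NumberField.RingOfIntegers F) F b)) → (∀ v : IsDedekindDomain.HeightOneSpectrum (NumberField.RingOfIntegers F), (((p : ℕ) : NumberField.RingOfIntegers F)) ∈ v.asIdeal → Literature.NumberTheory.Automorphic.IsSplitAt (QuaternionAlgebra F (algebraMap (NumberField.RingOfIntegers F) F a) (0 : F) (algebraMap (NumberField.RingOfIntegers F) F b)) v ∧ a * b ∉ v.asIdeal) → ∀ (S : Finset (IsDedekindDomain.HeightOneSpectrum (NumberField.RingOfIntegers F))), (∀ v : IsDedekindDomain.HeightOneSpectrum (NumberField.RingOfIntegers F), ((2 * p : ℕ) : NumberField.RingOfIntegers F) * a * b ∈ v.asIdeal → v ∈ S) → ∀ (U : ℕ → Subgroup (Literature.NumberTheory.Automorphic.finiteAdelicUnits F (QuaternionAlgebra F (algebraMap (NumberField.RingOfIntegers F) F a) (0 : F)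 (algebraMap (NumberField.RingOfIntegers F) F b)))) [∀ r, IsHeckeTriple (⊤ : Submonoid (Literature.NumberTheory.Automorphic.finiteAdelicUnits F (QuaternionAlgebra F (algebraMap (NumberField.RingOfIntegers F) F a) (0 : F) (algebraMap (NumberField.RingOfIntegers F) F b)))) (U r) (U r)], (∀ (r : ℕ) (u : Literature.NumberTheory.Automorphic.finiteAdelicUnits F (QuaternionAlgebra F (algebraMap (NumberField.RingOfIntegers F) F a) (0 : F) (algebraMap (NumberField.RingOfIntegers F) F b))), u ∈ U r ↔ (u ∈ U 0 ∧ ∀ i : Fin 4, ∃ y ∈ Literature.NumberTheory.Automorphic.integralFiniteAdeles F, Literature.NumberTheory.Automorphic.QuaternionAlgebra.adelicCoords a b (↑u - 1) i = ↑(p ^ r) * y)) → U 0 ≤ Literature.NumberTheory.Automorphic.QuaternionAlgebra.integralUnits a b → IsOpen (U 0 : Set (Literature.NumberTheory.Automorphic.finiteAdelicUnits F (QuaternionAlgebra F (algebraMap (NumberField.RingOfIntegers F) F a) (0 : F) (algebraMap (NumberField.RingOfIntegers F) F b)))) → (∀ v ∉ S, ∀ γ ∈ Literature.NumberTheory.Automorphic.QuaternionAlgebra.integralUnits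 a b, (∀ w : IsDedekindDomain.HeightOneSpectrum (NumberField.RingOfIntegers F), w ≠ v → ∀ i : Fin 4, (Literature.NumberTheory.Automorphic.QuaternionAlgebra.adelicCoords a b (↑γ - 1) i) w = 0) → γ ∈ U 0) → ∀ (x : IsDedekindDomain.HeightOneSpectrum (NumberField.RingOfIntegers F) → ↥O), (∀ v ∉ S, ρ.IsUnramifiedAt v ∧ ∃ c : PadicAlgCl p, ρ.HasFrobCharpolyAt v (Polynomial.X ^ 2 - Polynomial.C ((x v : ↥O) : PadicAlgCl p) * Polynomial.X + Polynomial.C c)) → (∀ e : ℕ, ∃ r : ℕ, ∃ f : Literature.NumberTheory.Automorphic.QuaternionicForm (QuaternionAlgebra F (algebraMap (NumberField.RingOfIntegers F) F a) (0 : F) (algebraMap (NumberField.RingOfIntegers F) F b)) (U r) (↥O ⧸ Ideal.span {(((p : ℕ) : ↥O)) ^ e}), (∃ u : Literature.NumberTheory.Automorphic.finiteAdelicUnits F (QuaternionAlgebra F (algebraMap (NumberField.RingOfIntegers F) F a) (0 : F) (algebraMap (NumberField.RingOfIntegers F) F b)), IsUnit (f u)) ∧ ∀ v ∉ S, ∀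 g : Literature.NumberTheory.Automorphic.finiteAdelicUnits F (QuaternionAlgebra F (algebraMap (NumberField.RingOfIntegers F) F a) (0 : F) (algebraMap (NumberField.RingOfIntegers F) F b)), (Literature.NumberTheory.Automorphic.QuaternionAlgebra.adelicEquiv a b ↑g ∈ Literature.NumberTheory.Automorphic.QuaternionAlgebra.adelicOrder a b ∧ (∀ w : IsDedekindDomain.HeightOneSpectrum (NumberField.RingOfIntegers F), w ≠ v → ∀ i : Fin 4, (Literature.NumberTheory.Automorphic.QuaternionAlgebra.adelicCoords a b (↑g - 1) i) w = 0) ∧ (∀ w : IsDedekindDomain.HeightOneSpectrum (NumberField.RingOfIntegers F), Valued.v (((Literature.NumberTheory.Automorphic.QuaternionAlgebra.adelicCoords a b ↑g 0 ^ 2 - algebraMap (NumberField.RingOfIntegers F) _ a * Literature.NumberTheory.Automorphic.QuaternionAlgebra.adelicCoords a b ↑g 1 ^ 2 - algebraMap (NumberField.RingOfIntegers F) _ b * Literature.NumberTheory.Automorphic.QuaternionAlgebra.adelicCoords a b ↑g 2 ^ 2 + algebraMap (NumberField.RingOfIntegers F) _ a * algebraMap (NumberField.RingOfIntegers F) _ b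 * Literature.NumberTheory.Automorphic.QuaternionAlgebra.adelicCoords a b ↑g 3 ^ 2) : (IsDedekindDomain.FiniteAdeleRing (NumberField.RingOfIntegers F) F)) w) = if w = v then WithZero.exp (-1) else 1)) → Literature.NumberTheory.Automorphic.QuaternionicForm.heckeOperator (↥O ⧸ Ideal.span {(((p : ℕ) : ↥O)) ^ e}) g f = (Ideal.Quotient.mk (Ideal.span {(((p : ℕ) : ↥O)) ^ e}) (x v)) • f) → (∀ (v : IsDedekindDomain.HeightOneSpectrum (NumberField.RingOfIntegers F)) (hv : ((p : ℕ) : NumberField.RingOfIntegers F) ∈ v.asIdeal), (Literature.NumberTheory.PAdicHodge.fontainePstAdicCompletion v p hv).IsCrystallineFramed (ρ.toLocal v) ∧ (letI := (Literature.NumberTheory.PAdicHodge.fontainePstAdicCompletion v p hv).algebra; Literature.NumberTheory.GaloisRepresentations.GaloisRep.IsLabelledHodgeTateRegular (Literature.NumberTheory.PAdicHodge.fontainePstAdicCompletion v p hv).𝔅 (ρ.toLocal v).toGaloisRep)) → ∃ π : Literature.NumberTheory.Automorphic.CuspidalAutomorphicRepData 2 F hcpt, π.1.IsLAlgebraic ∧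 (∃ T : Literature.NumberTheory.Automorphic.InfinityType F 2, π.1.HasInfinityType T ∧ T.IsLAlgebraic ∧ T.IsRegular) ∧ ∀ᶠ v in Filter.cofinite, Summit.Langlands.SatakeFrobCompatibleAt ι π.1 ρ v := by
  sorry

/-- **Stub (odd degree) — QUADRATIC TOTALLY REAL ASCENT OF THE HYPOTHESES.**  For `F` totally real
of ODD degree, `p ≥ 5` unramified in `F`, and `ρ` irreducible, totally odd, a.e. unramified,
`p`-adically automorphic (some tame level over `F`), crystalline with distinct labelled HT weights at
`v ∣ p`: there is a totally real quadratic extension `F'/F` (as a TYPE with `[Algebra F F']`,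
`finrank F F' = 2`, `[F':ℚ]` even, `p ∤ disc F'`) such that `ρ|_{Γ_{F'}} = ρ.restrictField F'` is
again irreducible, totally odd, a.e. unramified, `p`-ADICALLY AUTOMORPHIC over `F'` (some
`𝒰' : TameLevel 2 F' p`), and crystalline labelled-HT-regular at every `w ∣ p` of `F'`.  Why plausibly
true: take `F' = F(√q)` for a prime `q ≡ 1 (mod 4)`, `q ∤ p · disc F` (totally real, `p` unramified);
irreducibility of the restriction is AUTOMATIC (an odd irreducible `ρ` induced from a totally real
quadratic field would have equal labelled HT weights, contradicting regularity — or avoid the `≤ 3`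
dihedral fields); oddness and a.e.-unramifiedness restrict formally; crystallinity and labelled
weights are stable under the finite unramified base change `F'_w/F_v` (Fontaine); the ONE non-formal
clause is base change of PRO-MODULARITY (continuous points of `𝕋(K^p)` over `F` ↦ over `F'`): at
finite level it is Langlands' quadratic base change of cuspidal eigensystems (+ Eisenstein ones),
and the passage to closures needs the same torsion / boundary bookkeeping as `stub_definiteCarrier`
(cf. X. Zhang arXiv:2512.21249 Step 2, potential pro-modularity by abelian base change).  Size L.
[cite: LanglandsBaseChange1980] [cite: arXiv:2512.21249, Step 2] [cite: Fontaine1994, base change of B_cris] -/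
theorem stub_oddDegreeAscent : ∀ (F : Type) [Field F] [NumberField F], NumberField.IsTotallyReal F → Odd (Module.finrank ℚ F) → ∀ (p : ℕ) [Fact p.Prime], 5 ≤ p → ¬ ((p : ℤ) ∣ NumberField.discr F) → ∀ (ρ : Literature.NumberTheory.GaloisRepresentations.FramedGaloisRep F (PadicAlgCl p) 2), ρ.toGaloisRep.IsIrreducible → ρ.IsOdd → (∀ᶠ v in Filter.cofinite, ρ.IsUnramifiedAt v) → (∃ 𝒰 : Literature.NumberTheory.Automorphic.BigHeckeGLn.TameLevel 2 F p, 𝒰.IsPadicallyAutomorphic ρ) → (∀ (v : IsDedekindDomain.HeightOneSpectrum (NumberField.RingOfIntegers F)) (hv : ((p : ℕ) : NumberField.RingOfIntegers F) ∈ v.asIdeal), (Literature.NumberTheory.PAdicHodge.fontainePstAdicCompletion v p hv).IsCrystallineFramed (ρ.toLocal v) ∧ (letI := (Literature.NumberTheory.PAdicHodge.fontainePstAdicCompletion v p hv).algebra; Literature.NumberTheory.GaloisRepresentations.GaloisRep.IsLabelledHodgeTateRegular (Literature.NumberTheory.PAdicHodge.fontainePstAdicCompletion v p hv).𝔅 (ρ.toLocal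 v).toGaloisRep)) → ∃ (F' : Type) (_ : Field F') (_ : NumberField F') (_ : Algebra F F'), NumberField.IsTotallyReal F' ∧ Module.finrank F F' = 2 ∧ Even (Module.finrank ℚ F') ∧ ¬ ((p : ℤ) ∣ NumberField.discr F') ∧ (ρ.restrictField F').toGaloisRep.IsIrreducible ∧ (ρ.restrictField F').IsOdd ∧ (∀ᶠ w in Filter.cofinite, (ρ.restrictField F').IsUnramifiedAt w) ∧ (∃ 𝒰 : Literature.NumberTheory.Automorphic.BigHeckeGLn.TameLevel 2 F' p, 𝒰.IsPadicallyAutomorphic (ρ.restrictField F')) ∧ (∀ (v : IsDedekindDomain.HeightOneSpectrum (NumberField.RingOfIntegers F')) (hv : ((p : ℕ) : NumberField.RingOfIntegers F') ∈ v.asIdeal), (Literature.NumberTheory.PAdicHodge.fontainePstAdicCompletion v p hv).IsCrystallineFramed ((ρ.restrictField F').toLocal v) ∧ (letI := (Literature.NumberTheory.PAdicHodge.fontainePstAdicCompletion v p hv).algebra; Literature.NumberTheory.GaloisRepresentations.GaloisRep.IsLabelledHodgeTateRegular (Literature.NumberTheory.PAdicHodge.fontainePstAdicCompletion v p hv).𝔅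 ((ρ.restrictField F').toLocal v).toGaloisRep)) := by
  sorry

/-- **Stub (descent) — QUADRATIC DESCENT OF MODULARITY (in print modulo assembly).**  `F ⊆ F'`
totally real number fields with `finrank F F' = 2` (`[Algebra F F']`), `ρ : Γ_F → GL₂(ℚ̄_p)` whose
restriction `ρ.restrictField F'` is irreducible, and a cuspidal L-algebraic `π'` on `GL₂(𝔸_{F'})`
with a REGULAR L-algebraic infinity type and Satake–Frobenius matching with `ρ|_{Γ_{F'}}` at almost
all places of `F'`.  THEN some cuspidal L-algebraic `π` on `GL₂(𝔸_F)` matches `ρ` at almost all places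
of `F`.  Proof in print: `π'^σ` and `π'` have the same Satake parameters a.e. (`(ρ|_{F'})^σ ≅ ρ|_{F'}`),
so `π'^σ ≅ π'` (strong multiplicity one) and `π' = BC(π₀)` for a cuspidal `π₀` on `GL₂(𝔸_F)`
(Langlands 1980; Arthur–Clozel Ch. 3 Thm 4.2, the tree's named fact `cuspidal_descent_cyclic`; the
L-algebraic/regular infinity type descends, `ArthurClozel1989_strongLifting_archimedean`), `π₀` is
cohomological so `ρ_{π₀}` exists (Taylor 1989 / Blasius–Rogawski; tree `exists_galoisRep_of_regularAlgebraic`)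
with `ρ_{π₀}|_{F'} ≅ ρ_{π'} ≅ ρ|_{F'}` (Chebotarev + Brauer–Nesbitt), hence `ρ ≅ ρ_{π₀} ⊗ η^i`
(`η` the quadratic character of `F'/F`, `i ∈ {0,1}`, Clifford) and `π := π₀ ⊗ η^i`.  Regularity of
`π'` is assumed so that no exotic (Maass-type L-algebraic) `π'` has to be descended.  Size M/L
(cf. `Theorems/BaseFieldAscentReciprocityTRCMStubQuadraticDescentLAlgebraic.lean` for the same seam over
a CM quadratic `E/F`).  [cite: LanglandsBaseChange1980] [cite: ArthurClozelAMS120, Ch. 3 Thm 4.2 and 5.1]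
[cite: Taylor1989] [cite: BuzzardGeeLMS2014, §3] -/
theorem stub_quadraticDescent : ∀ (F : Type) [Field F] [NumberField F], NumberField.IsTotallyReal F → ∀ (F' : Type) [Field F'] [NumberField F'] [Algebra F F'], NumberField.IsTotallyReal F' → Module.finrank F F' = 2 → ∀ (p : ℕ) [Fact p.Prime] (hcpt : Literature.NumberTheory.Automorphic.isCompact_glFiniteIntegralLevel 2 F) (hcpt' : Literature.NumberTheory.Automorphic.isCompact_glFiniteIntegralLevel 2 F') (ι : PadicAlgCl p ≃+* ℂ) (ρ : Literature.NumberTheory.GaloisRepresentations.FramedGaloisRep F (PadicAlgCl p) 2), (ρ.restrictField F').toGaloisRep.IsIrreducible → (∃ π : Literature.NumberTheory.Automorphic.CuspidalAutomorphicRepData 2 F' hcpt', π.1.IsLAlgebraic ∧ (∃ T : Literature.NumberTheory.Automorphic.InfinityType F' 2, π.1.HasInfinityType T ∧ T.IsLAlgebraic ∧ T.IsRegular) ∧ ∀ᶠ v in Filter.cofinite, Summit.Langlands.SatakeFrobCompatibleAt ι π.1 (ρ.restrictField F') v) → ∃ π : Literature.NumberTheory.Automorphic.CuspidalAutomorphicRepData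 2 F hcpt, π.1.IsLAlgebraic ∧ ∀ᶠ v in Filter.cofinite, Summit.Langlands.SatakeFrobCompatibleAt ι π.1 ρ v := by
  sorry

/-! ## 2. The composition (pure logic; no `sorry` below this line) -/

/-- **The even-degree chain (pure logic):** `stub_definiteCarrier` → `stub_gkBoundAtPoint` →
`stub_noetherFlatOccupancy` → `stub_exitFromOccupancy` gives the crux for totally real fields of EVEN
degree, with the exit's extra output (a regular L-algebraic infinity type) kept for the descent. -/
theorem cruxEvenDegree : ∀ (F : Type) [Field F] [NumberField F], NumberField.IsTotallyReal F → Even (Module.finrank ℚ F) → ∀ (p : ℕ) [Fact p.Prime], 5 ≤ p → ¬ ((p : ℤ) ∣ NumberField.discr F) → ∀ (hcpt : Literature.NumberTheory.Automorphic.isCompact_glFiniteIntegralLevel 2 F) (ι : PadicAlgCl p ≃+* ℂ) (ρ : Literature.NumberTheory.GaloisRepresentations.FramedGaloisRep F (PadicAlgCl p) 2), ρ.toGaloisRep.IsIrreducible → ρ.IsOdd → (∀ᶠ v in Filter.cofinite, ρ.IsUnramifiedAt v) → (∃ 𝒰 : Literature.NumberTheory.Automorphic.BigHeckeGLn.TameLevel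 2 F p, 𝒰.IsPadicallyAutomorphic ρ) → (∀ (v : IsDedekindDomain.HeightOneSpectrum (NumberField.RingOfIntegers F)) (hv : ((p : ℕ) : NumberField.RingOfIntegers F) ∈ v.asIdeal), (Literature.NumberTheory.PAdicHodge.fontainePstAdicCompletion v p hv).IsCrystallineFramed (ρ.toLocal v) ∧ (letI := (Literature.NumberTheory.PAdicHodge.fontainePstAdicCompletion v p hv).algebra; Literature.NumberTheory.GaloisRepresentations.GaloisRep.IsLabelledHodgeTateRegular (Literature.NumberTheory.PAdicHodge.fontainePstAdicCompletion v p hv).𝔅 (ρ.toLocal v).toGaloisRep)) → ∃ π : Literature.NumberTheory.Automorphic.CuspidalAutomorphicRepData 2 F hcpt, π.1.IsLAlgebraic ∧ (∃ T : Literature.NumberTheory.Automorphic.InfinityType F 2, π.1.HasInfinityType T ∧ T.IsLAlgebraic ∧ T.IsRegular) ∧ ∀ᶠ v in Filter.cofinite, Summit.Langlands.SatakeFrobCompatibleAt ι π.1 ρ v := by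
  intro F _ _ hF hev p _ hp hdisc hcpt ι ρ hirr hodd hunr hpm hloc
  -- (S4) the carrier: a totally definite quaternionic tower over `F` and an `O`-point `x` of its Hecke algebras
  --      whose `T_v`-eigenvalues are the Frobenius traces of `ρ`
  obtain ⟨a, b, S, U, hHT, x, ha, hb, hdef, hsplit, hS, hU, hU0, hopen, hhyp, hpt, hassoc⟩ :=
    stub_definiteCarrier F hF hev p hp hdisc
      ((Valued.v : Valuation (PadicAlgCl p) NNReal).valuationSubring) rfl ρ hirr hodd hunr hpm
  haveI := hHT
  -- (S5) the DOOR at the maximal ideal of the point: Gelfand–Kirillov growth `≤ C · p ^ (r [F:ℚ])`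
  have hgk := stub_gkBoundAtPoint F hF hev p hp hdisc
    ((Valued.v : Valuation (PadicAlgCl p) NNReal).valuationSubring) rfl a b ha hb hdef hsplit S hS U
    hU hU0 hopen hhyp x hpt ⟨ρ, hirr, hodd, hassoc⟩
  -- (S1) Noether-flat occupancy: the point is OCCUPIED (primitive exact eigenforms modulo every `p ^ e`)
  have hocc := stub_noetherFlatOccupancy F hF hev p hp hdisc
    ((Valued.v : Valuation (PadicAlgCl p) NNReal).valuationSubring) rfl a b ha hb hdef hsplit S hS U
    hU hU0 hopen hhyp x hpt hgk
  -- (S6) the exit from an occupied point: crystalline + labelled-HT-regular ⇒ classical (cohomological weight)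
  exact stub_exitFromOccupancy F hF hev p hp hdisc
    ((Valued.v : Valuation (PadicAlgCl p) NNReal).valuationSubring) rfl hcpt ι ρ hirr hodd a b ha hb hdef
    hsplit S hS U hU hU0 hopen hhyp x hassoc hocc hloc

/-- **The line closes the crux modulo its six stubs.**  `Nat.even_or_odd [F:ℚ]`: even degree is
`cruxEvenDegree`; odd degree ascends along `stub_oddDegreeAscent` to a totally real quadratic `F'`
(even degree; `hcpt'` from `isCompact_glFiniteIntegralLevel_holds 2 F'`), runs `cruxEvenDegree` there
for `ρ.restrictField F'`, and descends with `stub_quadraticDescent`.  Concludes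
`Summit.Langlands.Langlands.Theses.EisensteinGelfandKirillov.CrystallineProModularClassical` BY NAME;
no `sorry` of its own (axioms beyond the stubs' `sorryAx`: propext / Classical.choice / Quot.sound). -/
theorem CrystallineProModularClassical_of : CrystallineProModularClassical := by
  intro F _ _ hF p _ hp hdisc hcpt ι ρ hirr hodd hunr hpm hloc
  rcases Nat.even_or_odd (Module.finrank ℚ F) with hev | hod
  · -- even degree: the definite carrier exists over `F` itself
    obtain ⟨π, hL, -, hsat⟩ := cruxEvenDegree F hF hev p hp hdisc hcpt ι ρ hirr hodd hunr hpm hloc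
    exact ⟨π, hL, hsat⟩
  · -- odd degree: ascend to a totally real quadratic `F'/F` (even degree), close there, descend
    obtain ⟨F', _, _, _, hF', h2, hev', hdisc', hirr', hodd', hunr', hpm', hloc'⟩ :=
      stub_oddDegreeAscent F hF hod p hp hdisc ρ hirr hodd hunr hpm hloc
    have h' := cruxEvenDegree F' hF' hev' p hp hdisc'
      (Literature.NumberTheory.Automorphic.isCompact_glFiniteIntegralLevel_holds 2 F') ι
      (ρ.restrictField F') hirr' hodd' hunr' hpm' hloc'
    exact stub_quadraticDescent F hF F' hF' h2 p hcpt
      (Literature.NumberTheory.Automorphic.isCompact_glFiniteIntegralLevel_holds 2 F') ι ρ hirr' h' 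

end

end Summit.Langlands.Langlands.Cruxes.CrystallineProModularClassical.NoetherFlatOccupancy
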